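import Summits.Ventures.QEC.CircuitDistance.ETowerTrans
import HarnessLib

/-!
# P3-PORT STEP 2 (E-fold tower): BASE COMPLETENESS BY ORBIT COUNTING (CARD-7 §5 S6a, PORT-SPEC S6 (a))
# (cell `qec`, experiment CDX, seat qec-cdx-type-1)

The base list `T₃` of the tower is certified complete NOT by search but by counting: for each weight `w`, the listed
representatives of weight `w` are kernel words, orbit-MINIMAL under the `ls·ms` translations of the `nb`-block small torus
(`canonical`), pairwise distinct, and the sum of their orbit sizes (`orbitSize`, the number of distinct translates) equals the
number `#X_w` of kernel words of weight `w` (supplied by the in-kernel weight-enumerator DP, S6b).  Then the orbits — pairwise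
disjoint, inside `X_w` — exhaust `X_w`: every kernel word of weight `w` is a translate of a listed one
(`matchedK_of_orbit_count`).  Abstract over the column function; generic; no data; no `native_decide`.
-/

namespace Summit.Ventures.QEC.CircuitDistance.ETower

open Summit.Ventures.QEC.Census Summit.Ventures.QEC.Census.Fold

/-! ## Orbits under the small-torus translations -/

/-- All translations `(da, db)`, `da < ls`, `db < ms`. -/
def trsList (ls ms : ℕ) : List (ℕ × ℕ) := (List.range ls).flatMap fun da => (List.range ms).map fun db => (da, db)

/-- The distinct translates of `r` (its orbit, as a duplicate-free list). -/
def orbitL (ls ms nb : ℕ) (r : ℕ) : List ℕ := ((trsList ls ms).map fun d => transWK ls ms nb d.1 d.2 r).dedup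

/-- ORBIT SIZE: the number of distinct translates. -/
def orbitSize (ls ms nb : ℕ) (r : ℕ) : ℕ := (orbitL ls ms nb r).length

/-- CANONICAL = minimal in its orbit (as a numeral). -/
def canonical (ls ms nb : ℕ) (r : ℕ) : Bool := (trsList ls ms).all fun d => decide (r ≤ transWK ls ms nb d.1 d.2 r)

/-- The kernel words of weight `w` on the window (the set being counted). -/
def Xw (col : ℕ → ℕ) (ls ms nb w : ℕ) : Finset ℕ :=
  (Finset.range (2 ^ (nb * (ls * ms)))).filter fun s => lin col (nb * (ls * ms)) 0 s = 0 ∧ popc (nb * (ls * ms)) s = w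

/-- Membership in `trsList`. -/
theorem mem_trsList {ls ms : ℕ} {d : ℕ × ℕ} : d ∈ trsList ls ms ↔ d.1 < ls ∧ d.2 < ms := by
  unfold trsList
  simp only [List.mem_flatMap, List.mem_range, List.mem_map]
  constructor
  · rintro ⟨da, hda, db, hdb, rfl⟩; exact ⟨hda, hdb⟩
  · rintro ⟨h1, h2⟩; exact ⟨d.1, h1, d.2, h2, rfl⟩

/-- Membership in an orbit. -/
theorem mem_orbitL {ls ms nb r x : ℕ} : x ∈ orbitL ls ms nb r ↔ ∃ da db, da < ls ∧ db < ms ∧ transWK ls ms nb da db r = x := by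
  unfold orbitL
  rw [List.mem_dedup, List.mem_map]
  constructor
  · rintro ⟨d, hd, rfl⟩; exact ⟨d.1, d.2, (mem_trsList.1 hd).1, (mem_trsList.1 hd).2, rfl⟩
  · rintro ⟨da, db, h1, h2, rfl⟩; exact ⟨(da, db), mem_trsList.2 ⟨h1, h2⟩, rfl⟩

/-- Any translate lies in the orbit (reduce the translation modulo the periods). -/
theorem transWK_mem_orbitL {ls ms : ℕ} (hl : 0 < ls) (hm : 0 < ms) (nb da db r : ℕ) :
    transWK ls ms nb da db r ∈ orbitL ls ms nb r :=
  mem_orbitL.2 ⟨da % ls, db % ms, Nat.mod_lt _ hl, Nat.mod_lt _ hm, transWK_mod nb da db r⟩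

/-- Membership in `Xw`. -/
theorem mem_Xw {col : ℕ → ℕ} {ls ms nb w s : ℕ} :
    s ∈ Xw col ls ms nb w ↔ s < 2 ^ (nb * (ls * ms)) ∧ kerK col (nb * (ls * ms)) s ∧ popc (nb * (ls * ms)) s = w := by
  unfold Xw kerK; rw [Finset.mem_filter, Finset.mem_range]

section Count

variable {ls ms : ℕ} (hl : 0 < ls) (hm : 0 < ms)
include hl hm

/-- The counted set is closed under translation. -/
theorem transWK_mem_Xw {col : ℕ → ℕ} {nb w : ℕ}
    (hK : ∀ da db s, s < 2 ^ (nb * (ls * ms)) → (kerK col (nb * (ls * ms)) s ↔ kerK col (nb * (ls * ms)) (transWK ls ms nb da db s)))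
    {s : ℕ} (hs : s ∈ Xw col ls ms nb w) (da db : ℕ) : transWK ls ms nb da db s ∈ Xw col ls ms nb w := by
  obtain ⟨hlt, hker, hpop⟩ := mem_Xw.1 hs
  exact mem_Xw.2 ⟨transWK_lt hl hm nb da db s, (hK da db s hlt).1 hker, by rw [popc_transWK hl hm, hpop]⟩

/-- A translate of a canonical word that is itself canonical is the word. -/
theorem eq_of_canonical {nb r₁ r₂ : ℕ} (h₁ : canonical ls ms nb r₁ = true) (h₂ : canonical ls ms nb r₂ = true)
    (hr₁ : r₁ < 2 ^ (nb * (ls * ms))) {da db : ℕ} (h : transWK ls ms nb da db r₁ = r₂) : r₁ = r₂ := by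
  unfold canonical at h₁ h₂
  rw [List.all_eq_true] at h₁ h₂
  have le12 : r₁ ≤ r₂ := by
    have := h₁ (da % ls, db % ms) (mem_trsList.2 ⟨Nat.mod_lt _ hl, Nat.mod_lt _ hm⟩)
    rw [decide_eq_true_eq] at this
    rwa [transWK_mod, h] at this
  have le21 : r₂ ≤ r₁ := by
    have := h₂ ((ls - da % ls) % ls, (ms - db % ms) % ms) (mem_trsList.2 ⟨Nat.mod_lt _ hl, Nat.mod_lt _ hm⟩)
    rw [decide_eq_true_eq] at this
    rw [transWK_mod, ← h, transWK_inv hl hm nb hr₁] at this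
    rwa [h] at this
  omega

/-- Orbits of distinct canonical words are disjoint. -/
theorem orbitL_disjoint {nb r₁ r₂ : ℕ} (h₁ : canonical ls ms nb r₁ = true) (h₂ : canonical ls ms nb r₂ = true)
    (hr₁ : r₁ < 2 ^ (nb * (ls * ms))) (hr₂ : r₂ < 2 ^ (nb * (ls * ms))) (hne : r₁ ≠ r₂) :
    Disjoint (orbitL ls ms nb r₁).toFinset (orbitL ls ms nb r₂).toFinset := by
  rw [Finset.disjoint_left]
  intro x hx₁ hx₂
  rw [List.mem_toFinset, mem_orbitL] at hx₁ hx₂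
  obtain ⟨da, db, -, -, rfl⟩ := hx₁
  obtain ⟨ea, eb, -, -, he⟩ := hx₂
  -- r₂ translates onto r₁'s orbit: r₁ = τ (r₂)
  have : transWK ls ms nb (ls - ea % ls + da) (ms - eb % ms + db) r₁ = r₂ := by
    rw [← transWK_transWK hl hm, ← he, transWK_inv hl hm nb hr₂]
  exact hne (eq_of_canonical hl hm h₁ h₂ hr₁ this)

/-- **ORBIT COUNTING ⇒ COVER.**  Kernel words of weight `w`, orbit-minimal, distinct, with orbit sizes summing to `#X_w`:
every kernel word of weight `w` on the window is a translate of a listed one. -/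
theorem matchedK_of_orbit_count {col : ℕ → ℕ} {nb w : ℕ}
    (hK : ∀ da db s, s < 2 ^ (nb * (ls * ms)) → (kerK col (nb * (ls * ms)) s ↔ kerK col (nb * (ls * ms)) (transWK ls ms nb da db s)))
    (reps : List ℕ) (hmem : ∀ r ∈ reps, r ∈ Xw col ls ms nb w) (hcanon : ∀ r ∈ reps, canonical ls ms nb r = true)
    (hnodup : reps.Nodup) (hsum : (reps.map (orbitSize ls ms nb)).sum = (Xw col ls ms nb w).card) :
    ∀ s ∈ Xw col ls ms nb w, MatchedK ls ms nb reps s := by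
  classical
  set U : Finset ℕ := reps.toFinset.biUnion fun r => (orbitL ls ms nb r).toFinset with hU
  have hsub : U ⊆ Xw col ls ms nb w := by
    intro x hx
    rw [hU, Finset.mem_biUnion] at hx
    obtain ⟨r, hr, hx⟩ := hx
    rw [List.mem_toFinset] at hr
    rw [List.mem_toFinset, mem_orbitL] at hx
    obtain ⟨da, db, -, -, rfl⟩ := hx
    exact transWK_mem_Xw hl hm hK (hmem r hr) da db
  have hdisj : (↑reps.toFinset : Set ℕ).PairwiseDisjoint fun r => (orbitL ls ms nb r).toFinset := by
    intro r₁ hr₁ r₂ hr₂ hne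
    rw [Finset.mem_coe, List.mem_toFinset] at hr₁ hr₂
    exact orbitL_disjoint hl hm (hcanon _ hr₁) (hcanon _ hr₂) (mem_Xw.1 (hmem _ hr₁)).1 (mem_Xw.1 (hmem _ hr₂)).1 hne
  have hcardU : U.card = (reps.map (orbitSize ls ms nb)).sum := by
    rw [hU, Finset.card_biUnion hdisj, List.sum_toFinset _ hnodup]
    congr 1
    refine List.map_congr_left fun r _ => ?_
    unfold orbitSize
    exact List.toFinset_card_of_nodup (List.nodup_dedup _)
  have hEq : U = Xw col ls ms nb w := Finset.eq_of_subset_of_card_le hsub (by rw [hcardU, hsum])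
  intro s hs
  rw [← hEq, hU, Finset.mem_biUnion] at hs
  obtain ⟨r, hr, hx⟩ := hs
  rw [List.mem_toFinset] at hr
  rw [List.mem_toFinset, mem_orbitL] at hx
  obtain ⟨da, db, -, -, rfl⟩ := hx
  exact ⟨r, hr, ls - da % ls, ms - db % ms, transWK_inv hl hm nb (mem_Xw.1 (hmem r hr)).1 da db⟩

/-- The same, for all weights `1 … W` at once, from per-weight sums over ONE list (entries of other weights contribute to other
sums); weight `0` is the zero word. -/
theorem base_of_orbit_count {col : ℕ → ℕ} {nb W : ℕ}
    (hK : ∀ da db s, s < 2 ^ (nb * (ls * ms)) → (kerK col (nb * (ls * ms)) s ↔ kerK col (nb * (ls * ms)) (transWK ls ms nb da db s)))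
    (reps : List ℕ) (hlt : ∀ r ∈ reps, r < 2 ^ (nb * (ls * ms))) (hker : ∀ r ∈ reps, kerK col (nb * (ls * ms)) r)
    (hcanon : ∀ r ∈ reps, canonical ls ms nb r = true) (hnodup : reps.Nodup)
    (hsum : ∀ w, 1 ≤ w → w ≤ W →
      ((reps.filter fun r => popc (nb * (ls * ms)) r == w).map (orbitSize ls ms nb)).sum = (Xw col ls ms nb w).card) :
    ∀ s, s < 2 ^ (nb * (ls * ms)) → kerK col (nb * (ls * ms)) s → popc (nb * (ls * ms)) s ≤ W →
      s = 0 ∨ MatchedK ls ms nb reps s := by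
  intro s hs hk hw
  by_cases h0 : popc (nb * (ls * ms)) s = 0
  · left
    -- a word of weight 0 below 2^n is 0
    have hz : ∀ i, i < nb * (ls * ms) → s.testBit i = false := by
      intro i hi
      rw [popc_eq_card] at h0
      have he := Finset.card_eq_zero.1 h0
      rw [Finset.filter_eq_empty_iff] at he
      have := he (Finset.mem_range.2 hi)
      simpa using this
    apply Nat.eq_of_testBit_eq; intro i
    rw [Nat.zero_testBit]
    by_cases hi : i < nb * (ls * ms)
    · exact hz i hi
    · exact Nat.testBit_lt_two_pow (lt_of_lt_of_le hs (Nat.pow_le_pow_right (by norm_num) (not_lt.1 hi)))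
  · right
    set w := popc (nb * (ls * ms)) s
    have h1 : 1 ≤ w := Nat.one_le_iff_ne_zero.2 h0
    set repsW := reps.filter fun r => popc (nb * (ls * ms)) r == w with hrepsW
    have hmemW : ∀ r ∈ repsW, r ∈ Xw col ls ms nb w := by
      intro r hr
      rw [hrepsW, List.mem_filter, beq_iff_eq] at hr
      exact mem_Xw.2 ⟨hlt r hr.1, hker r hr.1, hr.2⟩
    have hsX : s ∈ Xw col ls ms nb w := mem_Xw.2 ⟨hs, hk, rfl⟩
    obtain ⟨r, hr, da, db, h⟩ := matchedK_of_orbit_count hl hm hK repsW hmemW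
      (fun r hr => hcanon r (List.mem_of_mem_filter hr)) (hnodup.filter _) (hsum w h1 hw) s hsX
    exact ⟨r, List.mem_of_mem_filter hr, da, db, h⟩

end Count

end Summit.Ventures.QEC.CircuitDistance.ETower
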